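import Summits.RiemannHypothesis.RiemannHypothesis.Theses.GroundBarta
import Summits.RiemannHypothesis.RiemannHypothesis.Theorems.GroundBartaPolarPerronFrobeniusConeDenseOfOneSigned
import Summits.RiemannHypothesis.RiemannHypothesis.Theorems.GroundBartaPolarPerronFrobeniusGoodWindowsClosed
import HarnessLib

/-!
# RiemannHypothesis / GroundBarta — crux `PolarPerronFrobenius` (stmt-RiemannHypothesis-18390):
# the CONE BOTTOM `ε₊(a)` — the sign crux as an equality of two continuous energies; first bad height

Helper file (`--supports stmt-RiemannHypothesis-18390`), RH-free, Mathlib + landed tree files only, no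
definitions, no named facts.  Write `ε₊(a) := sInf (weilWindowSphereValues P₊ a)` for the bottom of the
windowed Weil form on the CONE of pointwise real `≥ 0` window tests (`P₊ g := ∀ t, Im g(t) = 0 ∧ 0 ≤ Re g(t)`;
Literature's restricted-sphere vocabulary `weilWindowSphereValues`, as for `ε_ev`, `ε_od`; no new definition —
the `sInf` is written out in every statement).

* `exists_isWeilTest_cone_sphere`, `continuousAt_coneBottom`, `coneBottom_anti`, `weilGroundEnergy_le_coneBottom`
  — the cone sphere is nonempty and dilation-stable, so `ε₊` is CONTINUOUS on `(0, ∞)` (the tree's uniform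
  dilation modulus, `stub_sectorContinuity_continuousAt_sInf`), antitone, and `ε(a) ≤ ε₊(a)`.
* `coneDense_iff_coneBottom_le`, `oneSigned_iff_coneBottom_eq` — **`GSP a ↔ ε₊(a) = ε(a)`** (with
  `oneSigned_iff_coneDense`, p174808): the Perron–Frobenius SIGN question at a window is the EQUALITY of two
  continuous antitone energy functions; the CONE GAP `ε₊(a) − ε(a) ≥ 0` vanishes exactly on the good windows
  (a variational handle: `ε₊(a)` is bounded above by every non-negative trial function).
* `coneBottom_eq_of_le_quarter` (`ε₊ = ε` on `(0, 1/4]`), `riemannHypothesis_of_cofinal_coneBottom_eq`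
  (cofinal equality ⇒ RH), `eventually_weilGroundEnergy_lt_coneBottom_of_not_riemannHypothesis`
  (¬RH ⇒ the cone gap is eventually POSITIVE).
* `exists_firstBadHeight_of_not_riemannHypothesis` — **¬RH ⇒ a FIRST BAD HEIGHT `a₁ ≥ 1/4`**: every window
  `0 < a ≤ a₁` is good and bad windows accumulate at `a₁` from the right (closedness, p174798; twin of
  `OddSector`'s first-bad-height dichotomy).
* `ae_odd_of_weilOddGroundEnergy_lt` — at a strictly odd-winning window EVERY ground state is odd a.e. (its
  even part would be an even ground state and pin `ε_ev = ε`), sharpening `changesSign_of_weilOddGroundEnergy_lt`.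

Prover B, speedrun unit `sr-gb-rung-b` (seat 3).  References: E. Bombieri, Rend. Lincei (9) 11 (2000) §4
(Problem 2, Thm 5); M. Suzuki, arXiv:2606.09096 Thm 1.3 (continuity in the window).
-/

set_option linter.dupNamespace false

noncomputable section

open MeasureTheory Complex Filter Set
open scoped Real Topology

namespace Summit.RiemannHypothesis.RiemannHypothesis.Theorems.PolarPerronFrobenius

open Literature.NumberTheory.LFunctions
open Summit.RiemannHypothesis.RiemannHypothesis.Theses.GroundBarta

/-! ### The cone sphere: nonempty, dilation-stable; continuity of the cone bottom -/

/-- **The cone sphere of a window `a > 0` is nonempty**: a normalised, pointwise real `≥ 0` smooth bump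
supported in `[-a, a]`. [folklore] -/
theorem exists_isWeilTest_cone_sphere {a : ℝ} (ha : 0 < a) :
    ∃ g : ℝ → ℂ, IsWeilTest g ∧ tsupport g ⊆ Icc (-a) a ∧ (∀ t, (g t).im = 0 ∧ 0 ≤ (g t).re) ∧
      ∫ t, ‖g t‖ ^ 2 = (1 : ℝ) := by
  -- adapted from `exists_isWeilTest_sphere_of_sign` (Literature/…/WeilGroundEnergyParitySplit.lean)
  set β : ContDiffBump (0 : ℝ) := ⟨a / 2, a, by positivity, by linarith⟩ with hβ
  have hrOut : β.rOut = a := by rw [hβ]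
  have hβ1 : β 0 = 1 := β.one_of_mem_closedBall (Metric.mem_closedBall_self β.rIn_pos.le)
  set g₀ : ℝ → ℂ := fun t ↦ ((β t : ℝ) : ℂ) with hg₀
  have hg₀t : IsWeilTest g₀ :=
    ⟨Complex.ofRealCLM.contDiff.comp β.contDiff, β.hasCompactSupport.comp_left Complex.ofReal_zero⟩
  have hsupp₀ : tsupport g₀ ⊆ Icc (-a) a := by
    refine (tsupport_comp_subset Complex.ofReal_zero _).trans ?_
    rw [β.tsupport_eq, Real.closedBall_eq_Icc, hrOut, zero_sub, zero_add]
  have hnn : 0 ≤ ∫ t, ‖g₀ t‖ ^ 2 := integral_nonneg fun _ ↦ by positivity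
  have hN : 0 < ∫ t, ‖g₀ t‖ ^ 2 := by
    rcases hnn.eq_or_lt with hz | hpos
    · exfalso
      have h0 : g₀ = 0 := hg₀t.eq_zero_of_integral_norm_sq_eq_zero hz.symm
      have h1 : (1 : ℂ) = 0 := by
        rw [← Complex.ofReal_one, ← hβ1, show ((β 0 : ℝ) : ℂ) = g₀ 0 from rfl, h0, Pi.zero_apply]
      exact one_ne_zero h1
    · exact hpos
  set N : ℝ := ∫ t, ‖g₀ t‖ ^ 2 with hN'
  set c : ℝ := (Real.sqrt N)⁻¹ with hc
  have hcpos : 0 < c := inv_pos.2 (Real.sqrt_pos.2 hN)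
  refine ⟨fun t ↦ (c : ℂ) * g₀ t, hg₀t.const_mul c, tsupport_mul_subset_right.trans hsupp₀,
    fun t ↦ ?_, ?_⟩
  · simp only [hg₀, Complex.mul_im, Complex.mul_re, Complex.ofReal_re, Complex.ofReal_im, mul_zero,
      zero_mul, add_zero, sub_zero]
    exact ⟨trivial, mul_nonneg hcpos.le (β.nonneg' t)⟩
  · simp only [norm_mul, mul_pow, Complex.norm_real, Real.norm_of_nonneg hcpos.le]
    rw [integral_const_mul, hc, inv_pow, Real.sq_sqrt hnn, inv_mul_cancel₀ hN.ne']

/-- The cone value set of a window `a > 0` is nonempty. [folklore] -/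
theorem weilWindowSphereValues_cone_nonempty {a : ℝ} (ha : 0 < a) :
    (weilWindowSphereValues (fun g : ℝ → ℂ ↦ ∀ t, (g t).im = 0 ∧ 0 ≤ (g t).re) a).Nonempty := by
  obtain ⟨g, hg, hs, hP, hn⟩ := exists_isWeilTest_cone_sphere ha
  exact ⟨_, g, hg, hs, hP, hn, rfl⟩

/-- The cone is dilation-stable: `g_η(t) = (1+η)^{1/2} g((1+η)t)` is pointwise real `≥ 0` if `g` is.
[folklore] -/
theorem cone_weilDilate {g : ℝ → ℂ} (hg : ∀ t, (g t).im = 0 ∧ 0 ≤ (g t).re) (η t : ℝ) :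
    (weilDilate η g t).im = 0 ∧ 0 ≤ (weilDilate η g t).re := by
  simp only [weilDilate_apply, Complex.mul_im, Complex.mul_re, Complex.ofReal_re, Complex.ofReal_im,
    (hg _).1, mul_zero, zero_mul, add_zero, sub_zero]
  exact ⟨trivial, mul_nonneg (Real.sqrt_nonneg _) (hg _).2⟩

/-- **The cone bottom `ε₊` is continuous at every window `a₀ > 0`** (Bombieri Thm 5 / Suzuki Thm 1.3 run
inside the dilation-stable cone: `stub_sectorContinuity_continuousAt_sInf`). [folklore] -/
theorem continuousAt_coneBottom {a₀ : ℝ} (ha₀ : 0 < a₀) :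
    ContinuousAt (fun a ↦ sInf (weilWindowSphereValues
      (fun g : ℝ → ℂ ↦ ∀ t, (g t).im = 0 ∧ 0 ≤ (g t).re) a)) a₀ :=
  stub_sectorContinuity_continuousAt_sInf (P := fun g : ℝ → ℂ ↦ ∀ t, (g t).im = 0 ∧ 0 ≤ (g t).re)
    (fun η _ _ hg t ↦ cone_weilDilate hg η t) (fun _ ha ↦ weilWindowSphereValues_cone_nonempty ha) ha₀

/-- `ε₊` is non-increasing on `(0, ∞)` (window inclusion). [folklore] -/
theorem coneBottom_anti {a b : ℝ} (hb : 0 < b) (hba : b ≤ a) :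
    sInf (weilWindowSphereValues (fun g : ℝ → ℂ ↦ ∀ t, (g t).im = 0 ∧ 0 ≤ (g t).re) a) ≤
      sInf (weilWindowSphereValues (fun g : ℝ → ℂ ↦ ∀ t, (g t).im = 0 ∧ 0 ≤ (g t).re) b) :=
  sInf_weilWindowSphereValues_anti _ (weilWindowSphereValues_cone_nonempty hb) hba

/-- `ε(a) ≤ ε₊(a)` at every window `a > 0` (the cone sphere is a sub-sphere). [folklore] -/
theorem weilGroundEnergy_le_coneBottom {a : ℝ} (ha : 0 < a) :
    weilGroundEnergy a ≤
      sInf (weilWindowSphereValues (fun g : ℝ → ℂ ↦ ∀ t, (g t).im = 0 ∧ 0 ≤ (g t).re) a) :=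
  le_sInf_weilWindowSphereValues (weilWindowSphereValues_cone_nonempty ha)
    fun _ hg hs _ hn ↦ weilGroundEnergy_le_of_sphere hg hs hn

/-! ### `GSP a ↔ ε₊(a) = ε(a)` -/

/-- **Cone density ⟺ `ε₊(a) ≤ ε(a)`** at a window `a > 0`. [folklore] -/
theorem coneDense_iff_coneBottom_le {a : ℝ} (ha : 0 < a) :
    (∀ h : ℝ → ℂ, IsWeilTest h → tsupport h ⊆ Icc (-a) a → ∫ t, ‖h t‖ ^ 2 = (1 : ℝ) →
      ∀ δ : ℝ, 0 < δ → ∃ w : ℝ → ℂ, IsWeilTest w ∧ tsupport w ⊆ Icc (-a) a ∧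
        (∀ t, (w t).im = 0 ∧ 0 ≤ (w t).re) ∧ ∫ t, ‖w t‖ ^ 2 = (1 : ℝ) ∧
        (weilQuadratic w).re ≤ (weilQuadratic h).re + δ) ↔
    sInf (weilWindowSphereValues (fun g : ℝ → ℂ ↦ ∀ t, (g t).im = 0 ∧ 0 ≤ (g t).re) a) ≤
      weilGroundEnergy a := by
  set S := weilWindowSphereValues (fun g : ℝ → ℂ ↦ ∀ t, (g t).im = 0 ∧ 0 ≤ (g t).re) a with hSdef
  have hne : S.Nonempty := weilWindowSphereValues_cone_nonempty ha
  have hbdd : BddBelow S := bddBelow_weilWindowSphereValues _ a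
  constructor
  · intro hcone
    refine le_of_forall_pos_lt_add fun δ hδ ↦ ?_
    -- a normalised window test within `δ/2` of the bottom
    have hεS : weilGroundEnergy a = sInf (weilWindowSphereValues (fun _ : ℝ → ℂ ↦ True) a) :=
      weilGroundEnergy_eq_sInf a
    obtain ⟨x, ⟨h, hh, hhs, -, hhn, rfl⟩, hx⟩ := exists_lt_of_csInf_lt
      (weilWindowSphereValues_top_nonempty ha)
      (show sInf (weilWindowSphereValues (fun _ : ℝ → ℂ ↦ True) a) < weilGroundEnergy a + δ / 2 by
        rw [← hεS]; linarith)
    obtain ⟨w, hw, hws, hwP, hwn, hwQ⟩ := hcone h hh hhs hhn (δ / 2) (half_pos hδ)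
    have hle : sInf S ≤ (weilQuadratic w).re := sInf_weilWindowSphereValues_le_re hw hws hwP hwn
    linarith
  · intro hle h hh hhs hhn δ hδ
    have hεh : weilGroundEnergy a ≤ (weilQuadratic h).re := weilGroundEnergy_le_of_sphere hh hhs hhn
    obtain ⟨x, ⟨w, hw, hws, hwP, hwn, rfl⟩, hx⟩ := exists_lt_of_csInf_lt hne
      (show sInf S < sInf S + δ by linarith)
    exact ⟨w, hw, hws, hwP, hwn, by linarith⟩

/-- **`GSP a ↔ ε₊(a) = ε(a)`**: a window carries a one-signed ground state of the full windowed Weil form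
iff the cone bottom equals the bottom (`oneSigned_iff_coneDense`, p174808, and `ε ≤ ε₊`). [folklore] -/
theorem oneSigned_iff_coneBottom_eq {a : ℝ} (ha : 0 < a) :
    (∃ u : ℝ → ℂ, IsWeilGroundState a u ∧ ∀ᵐ t : ℝ, t ∈ Ioo (-a) a → (u t).im = 0 ∧ 0 ≤ (u t).re) ↔
      sInf (weilWindowSphereValues (fun g : ℝ → ℂ ↦ ∀ t, (g t).im = 0 ∧ 0 ≤ (g t).re) a) =
        weilGroundEnergy a := by
  rw [oneSigned_iff_coneDense ha, coneDense_iff_coneBottom_le ha]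
  exact ⟨fun h ↦ le_antisymm h (weilGroundEnergy_le_coneBottom ha),  fun h ↦ h.le⟩

/-- **`ε₊ = ε` on `(0, 1/4]`** (small-window Perron–Frobenius, RH-free). [folklore] -/
theorem coneBottom_eq_of_le_quarter {a : ℝ} (ha : 0 < a) (ha' : a ≤ 1 / 4) :
    sInf (weilWindowSphereValues (fun g : ℝ → ℂ ↦ ∀ t, (g t).im = 0 ∧ 0 ≤ (g t).re) a) =
      weilGroundEnergy a := by
  obtain ⟨u, hu, hsign⟩ := swe_exists_nonneg_isWeilGroundState ha ha'
  exact (oneSigned_iff_coneBottom_eq ha).1 ⟨u, hu, hsign.mono fun t ht _ ↦ ht⟩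

/-- **Cofinal equality `ε₊(a) = ε(a)` proves RH** (= cofinal `GSP`, `riemannHypothesis_of_cofinal_oneSigned`).
[folklore] -/
theorem riemannHypothesis_of_cofinal_coneBottom_eq
    (h : ∀ A : ℝ, ∃ a : ℝ, A ≤ a ∧
      sInf (weilWindowSphereValues (fun g : ℝ → ℂ ↦ ∀ t, (g t).im = 0 ∧ 0 ≤ (g t).re) a) =
        weilGroundEnergy a) :
    RiemannHypothesis := by
  refine riemannHypothesis_of_cofinal_oneSigned fun A ↦ ?_
  obtain ⟨a, ha, heq⟩ := h (max A 1)
  have ha0 : 0 < a := lt_of_lt_of_le one_pos ((le_max_right A 1).trans ha)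
  exact ⟨a, (le_max_left A 1).trans ha, (oneSigned_iff_coneBottom_eq ha0).2 heq⟩

/-- **If RH fails, the cone gap is eventually positive**: `∀ᶠ a, ε(a) < ε₊(a)`. [folklore] -/
theorem eventually_weilGroundEnergy_lt_coneBottom_of_not_riemannHypothesis (hRH : ¬ RiemannHypothesis) :
    ∀ᶠ a in atTop, weilGroundEnergy a <
      sInf (weilWindowSphereValues (fun g : ℝ → ℂ ↦ ∀ t, (g t).im = 0 ∧ 0 ≤ (g t).re) a) := by
  filter_upwards [eventually_not_oneSigned_of_not_riemannHypothesis hRH, eventually_gt_atTop 0]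
    with a ha ha0
  refine lt_of_le_of_ne (weilGroundEnergy_le_coneBottom ha0) fun heq ↦ ?_
  obtain ⟨u, hu, hsign⟩ := (oneSigned_iff_coneBottom_eq ha0).2 heq.symm
  exact ha u hu hsign

/-! ### Off RH: the first bad height -/

/-- **If RH fails there is a FIRST BAD HEIGHT `a₁ ≥ 1/4`**: every window `0 < a ≤ a₁` carries a one-signed
ground state, while windows carrying none accumulate at `a₁` from the right (`(0, 1/4] ⊆ G`, `G` closed in
`(0, ∞)` and bounded off RH). [folklore] -/
theorem exists_firstBadHeight_of_not_riemannHypothesis (hRH : ¬ RiemannHypothesis) :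
    ∃ a₁ : ℝ, 1 / 4 ≤ a₁ ∧
      (∀ a : ℝ, 0 < a → a ≤ a₁ → ∃ u : ℝ → ℂ, IsWeilGroundState a u ∧
        ∀ᵐ t : ℝ, t ∈ Ioo (-a) a → (u t).im = 0 ∧ 0 ≤ (u t).re) ∧
      ∀ ε : ℝ, 0 < ε → ∃ a : ℝ, a₁ < a ∧ a < a₁ + ε ∧ ∀ u : ℝ → ℂ, IsWeilGroundState a u →
        ¬ (∀ᵐ t : ℝ, t ∈ Ioo (-a) a → (u t).im = 0 ∧ 0 ≤ (u t).re) := by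
  set Bad : Set ℝ := {a : ℝ | 0 < a ∧ ∀ u : ℝ → ℂ, IsWeilGroundState a u →
    ¬ (∀ᵐ t : ℝ, t ∈ Ioo (-a) a → (u t).im = 0 ∧ 0 ≤ (u t).re)} with hBad
  -- good windows: `(0, 1/4]`
  have hgood_small : ∀ a : ℝ, 0 < a → a ≤ 1 / 4 → ∃ u : ℝ → ℂ, IsWeilGroundState a u ∧
      ∀ᵐ t : ℝ, t ∈ Ioo (-a) a → (u t).im = 0 ∧ 0 ≤ (u t).re := fun a ha ha' ↦ by
    obtain ⟨u, hu, hsign⟩ := swe_exists_nonneg_isWeilGroundState ha ha'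
    exact ⟨u, hu, hsign.mono fun t ht _ ↦ ht⟩
  -- `Bad` is nonempty off RH and bounded below by `1/4`
  obtain ⟨A, hA⟩ := eventually_atTop.1 (eventually_not_oneSigned_of_not_riemannHypothesis hRH)
  have hne : Bad.Nonempty := ⟨max A 1, lt_of_lt_of_le one_pos (le_max_right _ _), hA _ (le_max_left _ _)⟩
  have hlb : ∀ b ∈ Bad, 1 / 4 < b := by
    intro b hb
    by_contra hle
    obtain ⟨u, hu, hsign⟩ := hgood_small b hb.1 (not_lt.1 hle)
    exact hb.2 u hu hsign
  have hbdd : BddBelow Bad := ⟨1 / 4, fun b hb ↦ (hlb b hb).le⟩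
  set a₁ : ℝ := sInf Bad with ha₁
  have ha₁q : 1 / 4 ≤ a₁ := le_csInf hne fun b hb ↦ (hlb b hb).le
  have ha₁pos : 0 < a₁ := lt_of_lt_of_le (by norm_num) ha₁q
  -- windows below `a₁` are good
  have hbelow : ∀ a : ℝ, 0 < a → a < a₁ → ∃ u : ℝ → ℂ, IsWeilGroundState a u ∧
      ∀ᵐ t : ℝ, t ∈ Ioo (-a) a → (u t).im = 0 ∧ 0 ≤ (u t).re := by
    intro a ha hlt
    by_contra hno
    have hmem : a ∈ Bad := ⟨ha, fun u hu hsign ↦ hno ⟨u, hu, hsign⟩⟩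
    exact (not_le.2 hlt) (csInf_le hbdd hmem)
  -- `a₁` itself is good (closedness: `a₁ - 1/(n+2) → a₁` through good windows)
  have ha₁good : ∃ u : ℝ → ℂ, IsWeilGroundState a₁ u ∧
      ∀ᵐ t : ℝ, t ∈ Ioo (-a₁) a₁ → (u t).im = 0 ∧ 0 ≤ (u t).re := by
    set b : ℕ → ℝ := fun n ↦ a₁ * (1 - 1 / ((n : ℝ) + 2)) with hbdef
    have hb : Tendsto b atTop (𝓝 a₁) := by
      have h1 : Tendsto (fun n : ℕ ↦ 1 / ((n : ℝ) + 2)) atTop (𝓝 0) := by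
        have := tendsto_one_div_add_atTop_nhds_zero_nat (𝕜 := ℝ).comp (tendsto_add_atTop_nat 1)
        refine this.congr fun n ↦ ?_
        simp only [Function.comp_apply, Nat.cast_add, Nat.cast_one]
        ring
      have h2 := (tendsto_const_nhds (x := (1 : ℝ))).sub h1
      rw [sub_zero] at h2
      simpa [hbdef] using h2.const_mul a₁
    refine gsp_seqClosed a₁ b ha₁pos hb fun n ↦ hbelow (b n) ?_ ?_
    · have : (0 : ℝ) < 1 - 1 / ((n : ℝ) + 2) := by
        rw [sub_pos, div_lt_one (by positivity)]; linarith [n.cast_nonneg (α := ℝ)]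
      exact mul_pos ha₁pos this
    · have : 1 - 1 / ((n : ℝ) + 2) < 1 := by
        have : (0 : ℝ) < 1 / ((n : ℝ) + 2) := by positivity
        linarith
      calc b n = a₁ * (1 - 1 / ((n : ℝ) + 2)) := rfl
        _ < a₁ * 1 := mul_lt_mul_of_pos_left this ha₁pos
        _ = a₁ := mul_one _
  refine ⟨a₁, ha₁q, fun a ha hle ↦ ?_, fun ε hε ↦ ?_⟩
  · rcases hle.lt_or_eq with hlt | heq
    · exact hbelow a ha hlt
    · rw [heq]; exact ha₁good
  · -- `a₁ ∉ Bad`, so the infimum is approached strictly from the right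
    obtain ⟨b, hbmem, hblt⟩ := exists_lt_of_csInf_lt hne (show sInf Bad < a₁ + ε by linarith)
    have hba : a₁ ≤ b := csInf_le hbdd hbmem
    have hne' : b ≠ a₁ := by
      rintro rfl
      obtain ⟨u, hu, hsign⟩ := ha₁good
      exact hbmem.2 u hu hsign
    exact ⟨b, lt_of_le_of_ne hba (Ne.symm hne'), hblt, hbmem.2⟩

/-! ### At a strictly odd-winning window every ground state is odd -/

/-- **Strict odd-winning forces odd ground states**: if `ε_od(a) < ε_ev(a)` then every ground state of the
full windowed form at `a` is ODD almost everywhere — its even part, were it non-zero in `L²`, would normalise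
to an even ground state (`isWeilGroundState_evenPart`) and pin `ε_ev(a) = ε(a) ≤ ε_od(a)`. [folklore] -/
theorem ae_odd_of_weilOddGroundEnergy_lt {a : ℝ} (hlt : weilOddGroundEnergy a < weilEvenGroundEnergy a)
    {u : ℝ → ℂ} (hu : IsWeilGroundState a u) : ∀ᵐ t : ℝ, u (-t) = -u t := by
  have hN0 : 0 ≤ ∫ t, ‖(u t + u (-t)) / 2‖ ^ 2 := integral_nonneg fun _ ↦ by positivity
  rcases hN0.eq_or_lt with hz | hpos
  · -- even part vanishes in `L²`
    have hm := GroundStatesConvergeToXi.memLp_evenPart hu.memLp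
    have hint : Integrable fun t ↦ ‖(u t + u (-t)) / 2‖ ^ 2 :=
      (memLp_two_iff_integrable_sq_norm hm.1).1 hm
    have hae := (integral_eq_zero_iff_of_nonneg (fun _ ↦ by positivity) hint).1 hz.symm
    filter_upwards [hae] with t ht
    have h0 : (u t + u (-t)) / 2 = 0 := by
      have : ‖(u t + u (-t)) / 2‖ = 0 := pow_eq_zero_iff (n := 2) two_ne_zero |>.1 ht
      exact norm_eq_zero.1 this
    linear_combination 2 * h0
  · exfalso
    have hv := GroundStatesConvergeToXi.isWeilGroundState_evenPart hu hpos
    have hev : weilEvenGroundEnergy a = weilGroundEnergy a :=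
      GroundStatesConvergeToXi.weilEvenGroundEnergy_eq_of_even_groundState hv fun t ↦ by
        simp only [neg_neg, add_comm (u (-t)) (u t)]
    have hle : weilGroundEnergy a ≤ weilOddGroundEnergy a := weilGroundEnergy_le_weilOddGroundEnergy a
    linarith

end Summit.RiemannHypothesis.RiemannHypothesis.Theorems.PolarPerronFrobenius

end
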